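import Literature.Probability.RandomPlanarGeometry.HexSAWTriangle
import Literature.Probability.RandomPlanarGeometry.HexSAWLowerBound
import HarnessLib

/-!
# Crux-strategist s2 — typed forms used in `STRATEGY-CENSUS.md` (crux `HexConjecture`, stmt-CriticalPhenomena-0808)

The STUCK goal of the live line is the lower regularity REG of the triangle tail `triDl`
(registered `stub_triDlLowerRegular`) / doubling (`stub_triDlDoubling`).  This file only TYPES the
strengthenings / transfers discussed in the census (no proofs of open statements; the two closed
lemmas are elementary equivalences used to show that the reformulations are reformulations).
-/

namespace Summit.CriticalPhenomena.SAWScalingLimit.Cruxes.HexConjecture.StrategistS2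

open Literature.Probability.RandomPlanarGeometry.SAW

/-- REG as registered (`stub_triDlLowerRegular`), restated for reference. -/
def TriDlLowerRegular : Prop :=
  ∃ C : ℝ, ∀ T : ℕ, 1 ≤ T → ∑ i ∈ Finset.range (T + 1), HV.triDl i ≤ C * ((T : ℝ) + 1) * HV.triDl T

/-- Doubling as registered (`stub_triDlDoubling`). -/
def TriDlDoubling : Prop :=
  ∃ q : ℝ, 1 / 2 < q ∧ ∃ T₀ : ℕ, ∀ T : ℕ, T₀ ≤ T → q * HV.triDl T ≤ HV.triDl (2 * T)

/-- S⁺ (Strengthen, census S4): the MATUSZEWSKA form of lower regularity — the lower Matuszewska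
index of `T ↦ triDl T` is `> -1`: one exponent `β < 1` and one constant `c > 0` such that
`triDl` never decays faster than `(S/T)^β` between ANY two scales `S ≤ T`.  Equivalent to REG up to
constants (census §Strengthen, S4) — so it buys no rigidity; it is the form in which the planted
counter-family of §Negation N6 is stated. -/
def TriDlLowerMatuszewska : Prop :=
  ∃ β : ℝ, β < 1 ∧ ∃ c : ℝ, 0 < c ∧ ∀ S T : ℕ, 1 ≤ S → S ≤ T →
    c * ((S : ℝ) / T) ^ β * HV.triDl S ≤ HV.triDl T

/-- S⁺ (census S4'): general-ratio doubling — some scale ratio `λ ≥ 2` over which `triDl` keeps MORE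
than the fraction `1/λ` of its value.  `λ = 2` is the registered doubling; any `λ` gives REG by the
landed `reg_of_doublingEventually` argument run in base `λ`. -/
def TriDlRatioLower : Prop :=
  ∃ l : ℕ, 2 ≤ l ∧ ∃ q : ℝ, 1 / (l : ℝ) < q ∧ ∃ T₀ : ℕ, ∀ T : ℕ, T₀ ≤ T → q * HV.triDl T ≤ HV.triDl (l * T)

/-- T⁺ (Transfer, census T4): the PURE-BRIDGE lower regularity — the same statement for the
critical strip-bridge partition function `B_T = HV.stripBlim T`, which (unlike `triDl`) is a RENEWAL
SEQUENCE (Kesten's irreducible-bridge decomposition + Kesten's relation `Σ_irr x_c^{|γ|} = 1`,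
BBDDG 2014 Lemma 11), so that by Erickson’s lemma `(n+1) ≤ U(n)·m(n) ≤ 2n+2` it is EQUIVALENT to
the strong-renewal LOWER bound `B_T · m(T) ≥ c` (`m` = truncated mean of the irreducible-bridge
height).  Implied by REG (`stripB_le_triDl` + `B ≤ cos(π/8)·D`); not known to imply it. -/
def BridgeLowerRegular : Prop :=
  ∃ C : ℝ, ∀ T : ℕ, 1 ≤ T → ∑ i ∈ Finset.range (T + 1), HV.stripBlim i ≤ C * ((T : ℝ) + 1) * HV.stripBlim T

/-- The registered doubling is the case `λ = 2` of `TriDlRatioLower`. [folklore] -/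
theorem triDlRatioLower_of_doubling (h : TriDlDoubling) : TriDlRatioLower := by
  obtain ⟨q, hq, T₀, hT⟩ := h
  refine ⟨2, le_rfl, q, ?_, T₀, fun T hT' => ?_⟩
  · simpa using hq
  · simpa using hT T hT'

/-- The Matuszewska form implies REG with `C = 1/(c (1-β))·…` — here only the trivial half
`TriDlLowerMatuszewska → (doubling with q = c·2^{-β} … )` is NOT claimed; we record the elementary
direction REG-scale-ratio: Matuszewska ⟹ every fixed-ratio lower bound. [folklore] -/
theorem ratio_of_matuszewska (h : TriDlLowerMatuszewska) (l : ℕ) (hl : 1 ≤ l) :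
    ∃ q : ℝ, 0 < q ∧ ∀ T : ℕ, 1 ≤ T → q * HV.triDl T ≤ HV.triDl (l * T) := by
  obtain ⟨β, hβ, c, hc, h⟩ := h
  refine ⟨c * ((1 : ℝ) / l) ^ β, by positivity, fun T hT => ?_⟩
  have hlT : T ≤ l * T := Nat.le_mul_of_pos_left T hl
  have := h T (l * T) hT hlT
  have hTpos : (0 : ℝ) < T := by exact_mod_cast hT
  have hlpos : (0 : ℝ) < l := by exact_mod_cast hl
  have hdiv : ((T : ℝ) / ((l * T : ℕ) : ℝ)) = 1 / (l : ℝ) := by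
    push_cast
    field_simp
  rw [hdiv] at this
  simpa [mul_comm, mul_left_comm, mul_assoc] using this

end Summit.CriticalPhenomena.SAWScalingLimit.Cruxes.HexConjecture.StrategistS2
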